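import Literature.Probability.Percolation.ZdFiveArmSeparatedGluing
import Literature.Probability.Percolation.FourArmGarbanMonotone
import Literature.Probability.Percolation.CrossingChains
import Literature.Probability.Percolation.FourArmGarbanFencedToSides
import HarnessLib

/-!
# Gluing two well-separated four-arm events across an annulus (bond percolation on `ℤ²`):
# the deterministic step

Topic `Literature/Probability/Percolation`; bond percolation on `ℤ² = Site 2`. PROOFS ONLY (no
definition, no named fact). Deterministic half of the gluing step of the quasi-multiplicativity of
the four-arm probability (`DuminilCopinManolescuTassion2021_zdFourArm_quasiMult`,
`ZdFourArmQuasiMult.lean`; H. Duminil-Copin, I. Manolescu, V. Tassion, PTRF 181 (2021), Prop. 6.3,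
whose printed proof is Kesten's: separate the arms, then glue — H. Kesten, CMP 109 (1987), Lemma 6
and (2.43); P. Nolin, EJP 13 (2008), §4.3 Prop. 12 (ii) [arXiv 0711.4948: Prop. 11]: "the free
spaces `r_i` will allow us to use locally an FKG-type inequality to further extend the `c_i`'s"):

given a configuration in the well-separated event `zdFourArmSep n ρ` of the small annulus
(`ZdFourArmSeparated.lean`), in the well-separated event `zdFourArmSep ρ' R` of the big annulus,
in four corridor-crossing events joining the outer fences at scale `ρ` to the inner fences at scale
`ρ'` (open left–right crossings of `[ρ+1, ρ'-1] × [0, ρ/64]` and its mirror image, closed-dual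
crossings of the face columns `[0, ρ/64]` between the face rows `ρ+1` and `ρ'-2` and its mirror
image) and in four corridor-crossing events continuing the inner fences at scale `n` inwards to the
sphere `‖·‖_∞ = r` (open crossings of `[r, n-1] × [0, h]`, dual crossings of the face columns
`[0, h']` between the face rows `r-1` and `n-2`, and mirror images), the configuration lies in the
cluster-form four-arm event `fourArmTwoClusters r R` (`mem_fourArmTwoClusters_of_glue`): the open
pieces assemble into two open crossings of `A_{r,R}` from `(±r, ·)` to `(±R, ·)`
(`ZdSepOpenArmR/L.exists_walk_of_outerCorridor/innerCorridor`, `ZdFiveArmSeparatedGluing.lean`),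
and the dual pieces into two closed-dual face walks from the faces `(c, r-1)`, `(c', -r)` hanging
from the inner top and bottom sides of `‖·‖_∞ = r` to the levels `R`, `-R-1`, which forbid an open
junction of the two inner ends inside the annulus (`not_openConnIn_sqAnnulus_of_dualArmsTB`,
`SqAnnulusDualBarrier.lean`). All corridor events are the tree's translated crossing events
`lrCrossingAt`, `dualTBCrossingAt`, so that RSW and Harris apply verbatim in the probabilistic
half.

* `ZdSepOpenArmR.exists_walk_of_innerCorridor_sharp`, `ZdSepOpenArmL.exists_walk_of_innerCorridor_sharp` —
  the inner gluing lemmas of `ZdFiveArmSeparatedGluing.lean` with the sharper conclusion that the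
  joining walk uses the inner attaching walk and the inner fence crossing only (needed for the big
  annulus, whose outer fences lie beyond `‖·‖_∞ = R`);
* `exists_faceWalk_exit_row_lt`, `exists_faceWalk_exit_row_ge` — a face walk from the rows `≥ r`
  (resp. `≤ -r - 1`) reaching a row `< r` (resp. `≥ -r`), stopped at its first exit (`exists_prefix_exit`),
  ends by a vertical step on the row `r - 1` (resp. `-r`) and every edge it crosses has both
  endpoints at height `≥ r` (resp. `≤ -r`), hence off the hole `‖·‖_∞ ≤ r - 1`;
* `ZdSepOpenArmR/L.carrier_subset_sqAnnulus`, `ZdSepOpenArmR/L.inner_subset_sqAnnulus`,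
  `ZdSepDualArmT/B.dartProp_of_fence`, `dartProp_of_rows_ge/le`, `dartProp_of_body` — location of
  the pieces (open pieces inside `A_{r,R}`, dual pieces off the hole);
* `mem_fourArmTwoClusters_of_glue` — **the glued configuration has four arms from `‖·‖_∞ = r` to
  `‖·‖_∞ = R`.**

## References

* H. Kesten, *Scaling relations for 2D-percolation*, Comm. Math. Phys. 109 (1987), §2, Lemma 6,
  (2.43) [KestenScalingCMP1987].
* P. Nolin, *Near-critical percolation in two dimensions*, EJP 13 (2008), §4.3 Prop. 12, Lemma 13,
  §4.5 Prop. 17 (arXiv 0711.4948: Prop. 11, Lemma 12, Prop. 16) [Nolin2008].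
* H. Duminil-Copin, I. Manolescu, V. Tassion, PTRF 181 (2021), §6.2 Prop. 6.3
  [DuminilCopinManolescuTassion2021].

Tree: `zdFourArmSep`, `zdSepOpenArmR` (`ZdFourArmSeparated.lean`), `ZdSepOpenArmR/L`,
`ZdSepDualArmT/B`, `zdSepOpenArmL`, `zdSepDualArmT/B` (`ZdFiveArmSeparated.lean`), the gluing and
surgery lemmas of `ZdFiveArmSeparatedGluing.lean`, `lrCrossingAt`, `exists_walk_of_mem_lrCrossingAt`
(`CrossingChains.lean`), `dualTBCrossingAt`, `exists_faceWalk_of_mem_dualTBCrossingAt`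
(`FourArmGarbanFencedToSides.lean`), `exists_prefix_exit` (`FourArmGarbanTwoArms.lean`),
`not_openConnIn_sqAnnulus_of_dualArmsTB` (`SqAnnulusDualBarrier.lean`), `fourArmTwoClusters`,
`mem_sqAnnulus_iff`, `mem_openConnIn_of_walk`.
-/

noncomputable section

open MeasureTheory Set

namespace Literature.Probability.Percolation

open LatticeModels SimpleGraph

/-! ### Inner gluing with the sharper support conclusion -/

section InnerSharp

variable {ω : BondConfig (Site 2)} {n N : ℕ} {lo' hi' B₀ : ℤ} {s y : Site 2}

/-- **Inner gluing, right arm, sharp form**: as `ZdSepOpenArmR.exists_walk_of_innerCorridor`, but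
the joining open walk uses only the inner attaching walk `P'` and the inner fence crossing `V'`
(so it stays inside `{n - n/8 ≤ x₀}` and within `n/8` of the inner endpoint). [cite: Nolin2008, §4.3, proof of Prop. 12 (arXiv 0711.4948: Prop. 11)] -/
theorem ZdSepOpenArmR.exists_walk_of_innerCorridor_sharp
    (A : ZdSepOpenArmR ω n N B₀ (B₀ + (n / 64 : ℕ)) lo' hi')
    (he : 1 ≤ n / 8) (T : (zdGraph 2).Walk s y) (hy : y 0 + 1 = n) (hs : s 0 ≤ (n : ℤ) - (n / 8 : ℕ))
    (hT : ∀ z ∈ T.support, z 0 + 1 ≤ n ∧ ((n : ℤ) - (n / 8 : ℕ) ≤ z 0 → B₀ ≤ z 1 ∧ z 1 ≤ B₀ + (n / 64 : ℕ))) :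
    ∃ m ∈ T.support, ∃ U : (zdGraph 2).Walk A.x m,
      (∀ z ∈ U.support, z ∈ A.P'.support ∨ z ∈ A.V'.support) ∧ ∀ e ∈ U.edges, e ∈ ω := by
  obtain ⟨q, T₁, hq, hT₁s, -⟩ :=
    exists_prefix_reach_le 0 T.reverse ((n : ℤ) - (n / 8 : ℕ)) (by omega) hs
  have hbox : ∀ z ∈ T₁.reverse.support, (n : ℤ) - (n / 8 : ℕ) ≤ z 0 ∧ z 0 ≤ (n : ℤ) - 1 ∧
      B₀ ≤ z 1 ∧ z 1 ≤ B₀ + (n / 64 : ℕ) := by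
    intro z hz
    rw [Walk.support_reverse, List.mem_reverse] at hz
    obtain ⟨h1, h2⟩ := hT₁s z hz
    rw [Walk.support_reverse, List.mem_reverse] at h2
    obtain ⟨h3, h4⟩ := hT z h2
    exact ⟨h1, by omega, h4 h1⟩
  have hx := A.hx
  obtain ⟨m, hmT, hmV⟩ := exists_mem_support_of_vFence (L := (n : ℤ) - (n / 8 : ℕ)) (R := (n : ℤ) - 1)
    (B₀ := B₀) (B₁ := B₀ + (n / 64 : ℕ)) A.V' (fun z hz => ⟨(A.hV' z hz).1, by have := (A.hV' z hz).2.1; omega⟩)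
    (by rw [A.hab'.1]; omega) (by rw [A.hab'.2]; omega) (by omega) T₁.reverse hq (by omega) hbox
  obtain ⟨Uv, hUvs, hUve⟩ := exists_walk_within_support A.V' A.hu' hmV
  have hmT' : m ∈ T.support := by
    rw [Walk.support_reverse, List.mem_reverse] at hmT
    have := (hT₁s m hmT).2
    rwa [Walk.support_reverse, List.mem_reverse] at this
  refine ⟨m, hmT', A.P'.append Uv, fun z hz => ?_, fun e he => ?_⟩
  · rw [Walk.mem_support_append_iff] at hz
    rcases hz with hz | hz
    · exact Or.inl hz
    · exact Or.inr (hUvs z hz)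
  · rw [Walk.edges_append, List.mem_append] at he
    rcases he with he | he
    · exact A.hP'o e he
    · exact A.hV'o e (hUve e he)

/-- **Inner gluing, left arm, sharp form** (mirror image of
`ZdSepOpenArmR.exists_walk_of_innerCorridor_sharp`). [cite: Nolin2008, §4.3, proof of Prop. 12 (arXiv 0711.4948: Prop. 11)] -/
theorem ZdSepOpenArmL.exists_walk_of_innerCorridor_sharp
    (A : ZdSepOpenArmL ω n N B₀ (B₀ + (n / 64 : ℕ)) lo' hi')
    (he : 1 ≤ n / 8) (T : (zdGraph 2).Walk s y) (hy : y 0 = -(n : ℤ) + 1) (hs : -(n : ℤ) + (n / 8 : ℕ) ≤ s 0)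
    (hT : ∀ z ∈ T.support, -(n : ℤ) + 1 ≤ z 0 ∧ (z 0 ≤ -(n : ℤ) + (n / 8 : ℕ) → B₀ ≤ z 1 ∧ z 1 ≤ B₀ + (n / 64 : ℕ))) :
    ∃ m ∈ T.support, ∃ U : (zdGraph 2).Walk A.x m,
      (∀ z ∈ U.support, z ∈ A.P'.support ∨ z ∈ A.V'.support) ∧ ∀ e ∈ U.edges, e ∈ ω := by
  obtain ⟨q, T₁, hq, hT₁s, -⟩ :=
    exists_prefix_reach_ge 0 T.reverse (-(n : ℤ) + (n / 8 : ℕ)) (by rw [hy]; omega) hs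
  have hbox : ∀ z ∈ T₁.support, -(n : ℤ) + 1 ≤ z 0 ∧ z 0 ≤ -(n : ℤ) + (n / 8 : ℕ) ∧
      B₀ ≤ z 1 ∧ z 1 ≤ B₀ + (n / 64 : ℕ) := by
    intro z hz
    obtain ⟨h1, h2⟩ := hT₁s z hz
    rw [Walk.support_reverse, List.mem_reverse] at h2
    obtain ⟨h3, h4⟩ := hT z h2
    exact ⟨h3, h1, h4 h1⟩
  have hx := A.hx
  obtain ⟨m, hmT, hmV⟩ := exists_mem_support_of_vFence (L := -(n : ℤ) + 1) (R := -(n : ℤ) + (n / 8 : ℕ))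
    (B₀ := B₀) (B₁ := B₀ + (n / 64 : ℕ)) A.V' (fun z hz => ⟨(A.hV' z hz).1, (A.hV' z hz).2.1⟩)
    (by rw [A.hab'.1]; omega) (by rw [A.hab'.2]; omega) (by omega) T₁ hy hq hbox
  obtain ⟨Uv, hUvs, hUve⟩ := exists_walk_within_support A.V' A.hu' hmV
  have hmT' : m ∈ T.support := by
    have := (hT₁s m hmT).2
    rwa [Walk.support_reverse, List.mem_reverse] at this
  refine ⟨m, hmT', A.P'.append Uv, fun z hz => ?_, fun e he => ?_⟩
  · rw [Walk.mem_support_append_iff] at hz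
    rcases hz with hz | hz
    · exact Or.inl hz
    · exact Or.inr (hUvs z hz)
  · rw [Walk.edges_append, List.mem_append] at he
    rcases he with he | he
    · exact A.hP'o e he
    · exact A.hV'o e (hUve e he)

end InnerSharp

/-! ### Face walks stopped at their first exit from a half-plane of rows -/

section Exit

variable {ω : BondConfig (Site 2)}

/-- The separating edge of a step of a face walk only depends on the unordered pair of faces.
[folklore] -/
theorem sepEdge_notMem_of_mem_edges {a b x z : Site 2} (W : (zdGraph 2).Walk a b)
    (hW : ∀ d ∈ W.darts, sepEdge d.fst d.snd ∉ ω) (h : s(x, z) ∈ W.edges) :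
    sepEdge x z ∉ ω := by
  rw [Walk.edges, List.mem_map] at h
  obtain ⟨d, hd, hdxz⟩ := h
  rcases Sym2.eq_iff.1 hdxz with ⟨h1, h2⟩ | ⟨h1, h2⟩
  · rw [← h1, ← h2]; exact hW d hd
  · rw [← h1, ← h2, sepEdge_comm]; exact hW d hd

/-- Every dart of a face walk crossing closed edges crosses a closed edge (restated through the
edge list, for sub-walks sharing edges). [folklore] -/
theorem forall_darts_sepEdge_notMem_of_edges {a b a' b' : Site 2} (W : (zdGraph 2).Walk a b)
    (hW : ∀ d ∈ W.darts, sepEdge d.fst d.snd ∉ ω) (U : (zdGraph 2).Walk a' b')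
    (hU : ∀ e ∈ U.edges, e ∈ W.edges) : ∀ d ∈ U.darts, sepEdge d.fst d.snd ∉ ω := by
  intro d hd
  refine sepEdge_notMem_of_mem_edges W hW (hU _ ?_)
  rw [Walk.edges, List.mem_map]
  exact ⟨d, hd, rfl⟩

/-- **First exit downwards.** A face walk crossing closed edges that starts in the rows `≥ r` and
ends in a row `< r` contains a face walk crossing closed edges from its start to a face `c` of the
row `r - 1`, entered by a vertical step, all of whose other faces lie in rows `≥ r` (and on the
original walk); every edge it crosses has both endpoints at height `≥ r`. [folklore] -/
theorem exists_faceWalk_exit_row_lt {a b : Site 2} (W : (zdGraph 2).Walk a b)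
    (hW : ∀ d ∈ W.darts, sepEdge d.fst d.snd ∉ ω) (r : ℤ) (ha : r ≤ a 1) (hb : b 1 < r) :
    ∃ (c : Site 2) (U : (zdGraph 2).Walk a c), c 1 = r - 1 ∧ c ∈ W.support ∧
      (∃ x ∈ W.support, x 0 = c 0 ∧ x 1 = r) ∧
      (∀ z ∈ U.support, z ∈ W.support) ∧
      (∀ d ∈ U.darts, sepEdge d.fst d.snd ∉ ω) ∧
      (∀ d ∈ U.darts, ∀ v ∈ sepEdge d.fst d.snd, r ≤ v 1) := by
  obtain ⟨x, z, q₁, hadj, hz, hq₁A, hq₁s, hq₁e, hxz⟩ :=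
    exists_prefix_exit (A := {v : Site 2 | r ≤ v 1}) W ha (by simpa using hb)
  have hx : r ≤ x 1 := hq₁A x q₁.end_mem_support
  have hz' : ¬ r ≤ z 1 := hz
  have hstep : x 1 = z 1 + 1 ∧ z 0 = x 0 := by
    rcases stepKind_of_adj hadj with ⟨h0, h1⟩ | ⟨h0, h1⟩ | ⟨h1, h0⟩ | ⟨h1, h0⟩ <;> omega
  have hq₁d : ∀ d ∈ q₁.darts, sepEdge d.fst d.snd ∉ ω :=
    forall_darts_sepEdge_notMem_of_edges W hW q₁ hq₁e
  refine ⟨z, q₁.concat hadj, by omega, W.snd_mem_support_of_mem_edges hxz,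
    ⟨x, hq₁s x q₁.end_mem_support, hstep.2.symm, by omega⟩, ?_, ?_, ?_⟩
  · intro v hv
    rw [Walk.support_concat, List.mem_append, List.mem_singleton] at hv
    rcases hv with hv | rfl
    · exact hq₁s v hv
    · exact W.snd_mem_support_of_mem_edges hxz
  · intro d hd
    rw [Walk.darts_concat, List.concat_eq_append, List.mem_append, List.mem_singleton] at hd
    rcases hd with hd | rfl
    · exact hq₁d d hd
    · exact sepEdge_notMem_of_mem_edges W hW hxz
  · intro d hd v hv
    have hfst : r ≤ d.fst 1 := by
      rw [Walk.darts_concat, List.concat_eq_append, List.mem_append, List.mem_singleton] at hd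
      rcases hd with hd | rfl
      · exact hq₁A _ (q₁.dart_fst_mem_support_of_mem_darts hd)
      · exact hx
    have := (sepEdge_apply_le hv).2.1
    exact hfst.trans ((le_max_left _ _).trans this)

/-- **First exit upwards** (mirror image): a face walk crossing closed edges that starts in the
rows `≤ -r - 1` and ends in a row `≥ -r` contains a face walk crossing closed edges from its start
to a face `c` of the row `-r`, entered by a vertical step, all of whose other faces lie in rows
`≤ -r - 1`; every edge it crosses has both endpoints at height `≤ -r`. [folklore] -/
theorem exists_faceWalk_exit_row_ge {a b : Site 2} (W : (zdGraph 2).Walk a b)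
    (hW : ∀ d ∈ W.darts, sepEdge d.fst d.snd ∉ ω) (r : ℤ) (ha : a 1 ≤ -r - 1) (hb : -r ≤ b 1) :
    ∃ (c : Site 2) (U : (zdGraph 2).Walk a c), c 1 = -r ∧ c ∈ W.support ∧
      (∃ x ∈ W.support, x 0 = c 0 ∧ x 1 = -r - 1) ∧
      (∀ z ∈ U.support, z ∈ W.support) ∧
      (∀ d ∈ U.darts, sepEdge d.fst d.snd ∉ ω) ∧
      (∀ d ∈ U.darts, ∀ v ∈ sepEdge d.fst d.snd, v 1 ≤ -r) := by
  obtain ⟨x, z, q₁, hadj, hz, hq₁A, hq₁s, hq₁e, hxz⟩ :=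
    exists_prefix_exit (A := {v : Site 2 | v 1 ≤ -r - 1}) W ha (by simpa using hb)
  have hx : x 1 ≤ -r - 1 := hq₁A x q₁.end_mem_support
  have hz' : ¬ z 1 ≤ -r - 1 := hz
  have hstep : z 1 = x 1 + 1 ∧ z 0 = x 0 := by
    rcases stepKind_of_adj hadj with ⟨h0, h1⟩ | ⟨h0, h1⟩ | ⟨h1, h0⟩ | ⟨h1, h0⟩ <;> omega
  have hzx : z = x + Pi.single 1 1 := by
    simp only [LatticeModels.Site.eq_iff_two, Pi.add_apply, single_one_apply_zero, single_one_apply_one]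
    omega
  have hq₁d : ∀ d ∈ q₁.darts, sepEdge d.fst d.snd ∉ ω :=
    forall_darts_sepEdge_notMem_of_edges W hW q₁ hq₁e
  refine ⟨z, q₁.concat hadj, by omega, W.snd_mem_support_of_mem_edges hxz,
    ⟨x, hq₁s x q₁.end_mem_support, hstep.2.symm, by omega⟩, ?_, ?_, ?_⟩
  · intro v hv
    rw [Walk.support_concat, List.mem_append, List.mem_singleton] at hv
    rcases hv with hv | rfl
    · exact hq₁s v hv
    · exact W.snd_mem_support_of_mem_edges hxz
  · intro d hd
    rw [Walk.darts_concat, List.concat_eq_append, List.mem_append, List.mem_singleton] at hd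
    rcases hd with hd | rfl
    · exact hq₁d d hd
    · exact sepEdge_notMem_of_mem_edges W hW hxz
  · intro d hd v hv
    rw [Walk.darts_concat, List.concat_eq_append, List.mem_append, List.mem_singleton] at hd
    rcases hd with hd | rfl
    · have h1 := hq₁A _ (q₁.dart_fst_mem_support_of_mem_darts hd)
      have h2 := hq₁A _ (q₁.dart_snd_mem_support_of_mem_darts hd)
      have := (sepEdge_apply_le hv).2.2
      have hmax : max (d.fst 1) (d.snd 1) ≤ -r - 1 := max_le h1 h2
      omega
    · -- the last step is `x → x + e₁`: the crossed edge is the bottom side of the face `z`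
      change v ∈ sepEdge x z at hv
      rw [hzx, sepEdge_up] at hv
      rcases Sym2.mem_iff.1 hv with rfl | rfl
      · simp only [Pi.add_apply, single_one_apply_one]; omega
      · simp only [Pi.add_apply, single_one_apply_one, single_zero_apply_one]; omega

end Exit

/-! ### Bookkeeping: boxes, annuli, concatenation of walks with properties -/

section Book

variable {ω : BondConfig (Site 2)}

/-- Membership in the square annulus from coordinate bounds. [folklore] -/
theorem mem_sqAnnulus_of_bounds {r R : ℕ} (hr : 1 ≤ r) {v : Site 2} (h0 : -(R : ℤ) ≤ v 0)
    (h0' : v 0 ≤ R) (h1 : -(R : ℤ) ≤ v 1) (h1' : v 1 ≤ R)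
    (hbig : (r : ℤ) ≤ v 0 ∨ v 0 ≤ -(r : ℤ) ∨ (r : ℤ) ≤ v 1 ∨ v 1 ≤ -(r : ℤ)) :
    v ∈ sqAnnulus r R := by
  rw [mem_sqAnnulus_iff hr, Fin.forall_fin_two, Fin.exists_fin_two]
  exact ⟨⟨⟨h0, h0'⟩, ⟨h1, h1'⟩⟩, by tauto⟩

/-- A site with a coordinate `≥ k + 1` is off the box `B(k)`. [folklore] -/
theorem notMem_box_of_lt_apply {k : ℕ} {v : Site 2} (i : Fin 2) (h : (k : ℤ) + 1 ≤ v i) :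
    v ∉ box 2 k := fun hv => by have := (mem_box.1 hv i).2; omega

/-- A site with a coordinate `≤ -k - 1` is off the box `B(k)`. [folklore] -/
theorem notMem_box_of_apply_lt {k : ℕ} {v : Site 2} (i : Fin 2) (h : v i + 1 ≤ -(k : ℤ)) :
    v ∉ box 2 k := fun hv => by have := (mem_box.1 hv i).1; omega

/-- Sites of `A_{m,n}` are off every box `B(k)` with `k + 1 ≤ m`. [folklore] -/
theorem notMem_box_of_mem_sqAnnulus {m n k : ℕ} (hk : k + 1 ≤ m) {v : Site 2}
    (hv : v ∈ sqAnnulus m n) : v ∉ box 2 k := by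
  intro h
  rw [sqAnnulus, Finset.mem_coe, mem_annulus] at hv
  exact hv.2 (box_mono 2 (by omega) h)

/-- Open walks inside a region concatenate. [folklore] -/
theorem openWalk_append {S : Set (Site 2)} {a b c : Site 2} (p : (zdGraph 2).Walk a b)
    (q : (zdGraph 2).Walk b c) (hp : (∀ z ∈ p.support, z ∈ S) ∧ ∀ e ∈ p.edges, e ∈ ω)
    (hq : (∀ z ∈ q.support, z ∈ S) ∧ ∀ e ∈ q.edges, e ∈ ω) :
    (∀ z ∈ (p.append q).support, z ∈ S) ∧ ∀ e ∈ (p.append q).edges, e ∈ ω := by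
  refine ⟨fun z hz => ?_, fun e he => ?_⟩
  · rw [Walk.mem_support_append_iff] at hz
    exact hz.elim (hp.1 z) (hq.1 z)
  · rw [Walk.edges_append, List.mem_append] at he
    exact he.elim (hp.2 e) (hq.2 e)

/-- Open walks inside a region reverse. [folklore] -/
theorem openWalk_reverse {S : Set (Site 2)} {a b : Site 2} (p : (zdGraph 2).Walk a b)
    (hp : (∀ z ∈ p.support, z ∈ S) ∧ ∀ e ∈ p.edges, e ∈ ω) :
    (∀ z ∈ p.reverse.support, z ∈ S) ∧ ∀ e ∈ p.reverse.edges, e ∈ ω := by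
  refine ⟨fun z hz => ?_, fun e he => ?_⟩
  · rw [Walk.support_reverse, List.mem_reverse] at hz; exact hp.1 z hz
  · rw [Walk.edges_reverse, List.mem_reverse] at he; exact hp.2 e he

/-- Face walks crossing closed edges off `B(k)` concatenate. [folklore] -/
theorem faceWalk_append {k : ℕ} {a b c : Site 2} (p : (zdGraph 2).Walk a b) (q : (zdGraph 2).Walk b c)
    (hp : ∀ d ∈ p.darts, sepEdge d.fst d.snd ∉ ω ∧ ∀ v ∈ sepEdge d.fst d.snd, v ∉ box 2 k)
    (hq : ∀ d ∈ q.darts, sepEdge d.fst d.snd ∉ ω ∧ ∀ v ∈ sepEdge d.fst d.snd, v ∉ box 2 k) :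
    ∀ d ∈ (p.append q).darts, sepEdge d.fst d.snd ∉ ω ∧ ∀ v ∈ sepEdge d.fst d.snd, v ∉ box 2 k := by
  intro d hd
  rw [Walk.darts_append, List.mem_append] at hd
  exact hd.elim (hp d) (hq d)

/-- The dart property is invariant under reversing the dart. [folklore] -/
theorem faceDart_symm {k : ℕ} {d : (zdGraph 2).Dart}
    (h : sepEdge d.fst d.snd ∉ ω ∧ ∀ v ∈ sepEdge d.fst d.snd, v ∉ box 2 k) :
    sepEdge d.symm.fst d.symm.snd ∉ ω ∧ ∀ v ∈ sepEdge d.symm.fst d.symm.snd, v ∉ box 2 k := by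
  rw [sepEdge_dart_symm]; exact h

/-- Face walks crossing closed edges off `B(k)` reverse. [folklore] -/
theorem faceWalk_reverse {k : ℕ} {a b : Site 2} (p : (zdGraph 2).Walk a b)
    (hp : ∀ d ∈ p.darts, sepEdge d.fst d.snd ∉ ω ∧ ∀ v ∈ sepEdge d.fst d.snd, v ∉ box 2 k) :
    ∀ d ∈ p.reverse.darts, sepEdge d.fst d.snd ∉ ω ∧ ∀ v ∈ sepEdge d.fst d.snd, v ∉ box 2 k := by
  intro d hd
  rw [Walk.darts_reverse, List.mem_reverse, List.mem_map] at hd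
  obtain ⟨d', hd', rfl⟩ := hd
  exact faceDart_symm (hp d' hd')

/-- A face walk extracted from another one (steps of it or their reversals) inherits the dart
property. [folklore] -/
theorem faceWalk_of_within {k : ℕ} {a b u m : Site 2} (C : (zdGraph 2).Walk a b)
    (hC : ∀ d ∈ C.darts, sepEdge d.fst d.snd ∉ ω ∧ ∀ v ∈ sepEdge d.fst d.snd, v ∉ box 2 k)
    (U : (zdGraph 2).Walk u m) (hU : ∀ e ∈ U.darts, e ∈ C.darts ∨ e.symm ∈ C.darts) :
    ∀ d ∈ U.darts, sepEdge d.fst d.snd ∉ ω ∧ ∀ v ∈ sepEdge d.fst d.snd, v ∉ box 2 k := by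
  intro d hd
  rcases hU d hd with h | h
  · exact hC d h
  · have := faceDart_symm (hC _ h)
    rwa [Dart.symm_symm] at this

end Book

/-! ### Locating the pieces: open pieces in `A_{r,R}`, dual pieces off the hole `B(r-1)` -/

section Locate

variable {ω : BondConfig (Site 2)}

/-- A corridor box `[a, b] × [0, h]` with `r ≤ a`, `b ≤ R`, `h ≤ R` lies in `A_{r,R}`. [folklore] -/
theorem mem_sqAnnulus_of_corridorR {r R : ℕ} (hr : 1 ≤ r) {a b h : ℤ} (ha : (r : ℤ) ≤ a) (hb : b ≤ R)
    (hh : h ≤ R) {z : Site 2} (hz : a ≤ z 0 ∧ z 0 ≤ b ∧ 0 ≤ z 1 ∧ z 1 ≤ h) : z ∈ sqAnnulus r R :=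
  mem_sqAnnulus_of_bounds hr (by omega) (by omega) (by omega) (by omega) (Or.inl (by omega))

/-- Mirror image: a corridor box `[a, b] × [0, h]` with `b ≤ -r`, `-R ≤ a`. [folklore] -/
theorem mem_sqAnnulus_of_corridorL {r R : ℕ} (hr : 1 ≤ r) {a b h : ℤ} (ha : -(R : ℤ) ≤ a) (hb : b ≤ -(r : ℤ))
    (hh : h ≤ R) {z : Site 2} (hz : a ≤ z 0 ∧ z 0 ≤ b ∧ 0 ≤ z 1 ∧ z 1 ≤ h) : z ∈ sqAnnulus r R :=
  mem_sqAnnulus_of_bounds hr (by omega) (by omega) (by omega) (by omega) (Or.inr (Or.inl (by omega)))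

/-- **The carrier of a fenced right arm of `A_{n,ρ}` lies in `A_{r,R}`** when `r + n/8 ≤ n ≤ ρ` and
`ρ + ρ/8 ≤ R` (landing heights `[0, ·/64]`). [folklore] -/
theorem ZdSepOpenArmR.carrier_subset_sqAnnulus {n ρ r R : ℕ}
    (A : ZdSepOpenArmR ω n ρ 0 (0 + (n / 64 : ℕ)) 0 (0 + (ρ / 64 : ℕ)))
    (hr : 1 ≤ r) (h1 : r + n / 8 ≤ n) (h2 : n ≤ ρ) (h3 : ρ + ρ / 8 ≤ R) :
    ∀ z ∈ A.carrier, z ∈ sqAnnulus r R := by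
  intro z hz
  have e1 : ρ / 64 + ρ / 64 + ρ / 8 ≤ ρ := by omega
  have e2 : n / 64 + n / 64 + n / 8 ≤ n := by omega
  rcases A.carrier_subset (B := (n / 64 : ℕ)) (B' := (ρ / 64 : ℕ)) (abs_le.2 ⟨by omega, by omega⟩)
    (abs_le.2 ⟨by omega, by omega⟩) (abs_le.2 ⟨by omega, by omega⟩) (abs_le.2 ⟨by omega, by omega⟩)
    hz with h | ⟨h0, h0', h1'⟩ | ⟨h0, h0', h1'⟩
  · exact sqAnnulus_mono (by omega) (by omega) h
  · have := abs_le.1 h1'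
    have e1' : ((ρ / 64 : ℕ) : ℤ) + (ρ / 64 : ℕ) + (ρ / 8 : ℕ) ≤ ρ := by exact_mod_cast e1
    exact mem_sqAnnulus_of_bounds hr (by omega) (by omega) (by omega) (by omega) (Or.inl (by omega))
  · have := abs_le.1 h1'
    have e2' : ((n / 64 : ℕ) : ℤ) + (n / 64 : ℕ) + (n / 8 : ℕ) ≤ n := by exact_mod_cast e2
    exact mem_sqAnnulus_of_bounds hr (by omega) (by omega) (by omega) (by omega) (Or.inl (by omega))

/-- Mirror image for a fenced left arm. [folklore] -/
theorem ZdSepOpenArmL.carrier_subset_sqAnnulus {n ρ r R : ℕ}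
    (A : ZdSepOpenArmL ω n ρ 0 (0 + (n / 64 : ℕ)) 0 (0 + (ρ / 64 : ℕ)))
    (hr : 1 ≤ r) (h1 : r + n / 8 ≤ n) (h2 : n ≤ ρ) (h3 : ρ + ρ / 8 ≤ R) :
    ∀ z ∈ A.carrier, z ∈ sqAnnulus r R := by
  intro z hz
  have e1 : ρ / 64 + ρ / 64 + ρ / 8 ≤ ρ := by omega
  have e2 : n / 64 + n / 64 + n / 8 ≤ n := by omega
  rcases A.carrier_subset (B := (n / 64 : ℕ)) (B' := (ρ / 64 : ℕ)) (abs_le.2 ⟨by omega, by omega⟩)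
    (abs_le.2 ⟨by omega, by omega⟩) (abs_le.2 ⟨by omega, by omega⟩) (abs_le.2 ⟨by omega, by omega⟩)
    hz with h | ⟨h0, h0', h1'⟩ | ⟨h0, h0', h1'⟩
  · exact sqAnnulus_mono (by omega) (by omega) h
  · have := abs_le.1 h1'
    have e1' : ((ρ / 64 : ℕ) : ℤ) + (ρ / 64 : ℕ) + (ρ / 8 : ℕ) ≤ ρ := by exact_mod_cast e1
    exact mem_sqAnnulus_of_bounds hr (by omega) (by omega) (by omega) (by omega) (Or.inr (Or.inl (by omega)))
  · have := abs_le.1 h1'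
    have e2' : ((n / 64 : ℕ) : ℤ) + (n / 64 : ℕ) + (n / 8 : ℕ) ≤ n := by exact_mod_cast e2
    exact mem_sqAnnulus_of_bounds hr (by omega) (by omega) (by omega) (by omega) (Or.inr (Or.inl (by omega)))

/-- **The inner attaching walk and inner fence of a fenced right arm of `A_{ρ',R}` lie in
`A_{r,R}`** when `r + ρ'/8 ≤ ρ'` and `ρ' + ρ'/8 ≤ R`. [folklore] -/
theorem ZdSepOpenArmR.inner_subset_sqAnnulus {ρ' R r : ℕ} {lo' hi' : ℤ}
    (A : ZdSepOpenArmR ω ρ' R 0 (0 + (ρ' / 64 : ℕ)) lo' hi')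
    (hr : 1 ≤ r) (h1 : r + ρ' / 8 ≤ ρ') (h2 : ρ' + ρ' / 8 ≤ R) {z : Site 2}
    (hz : z ∈ A.P'.support ∨ z ∈ A.V'.support) : z ∈ sqAnnulus r R := by
  have hx := A.hx
  have e0 : ((ρ' / 64 : ℕ) : ℤ) ≤ (ρ' / 8 : ℕ) := by exact_mod_cast Nat.div_le_div_left (by norm_num) (by norm_num)
  have e3 : ρ' / 8 + ρ' / 8 ≤ ρ' := by omega
  have e3' : ((ρ' / 8 : ℕ) : ℤ) + (ρ' / 8 : ℕ) ≤ ρ' := by exact_mod_cast e3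
  rcases hz with h | h
  · obtain ⟨h0, h1'⟩ := A.hP' z h
    have a0 := abs_le.1 (show |z 0 - A.x 0| ≤ (ρ' / 8 : ℕ) by omega)
    have a1 := abs_le.1 (show |z 1 - A.x 1| ≤ (ρ' / 8 : ℕ) by omega)
    exact mem_sqAnnulus_of_bounds hr (by omega) (by omega) (by omega) (by omega) (Or.inl (by omega))
  · obtain ⟨h0, h0', h1'⟩ := A.hV' z h
    have a1 := abs_le.1 h1'
    exact mem_sqAnnulus_of_bounds hr (by omega) (by omega) (by omega) (by omega) (Or.inl (by omega))

/-- Mirror image for a fenced left arm of `A_{ρ',R}`. [folklore] -/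
theorem ZdSepOpenArmL.inner_subset_sqAnnulus {ρ' R r : ℕ} {lo' hi' : ℤ}
    (A : ZdSepOpenArmL ω ρ' R 0 (0 + (ρ' / 64 : ℕ)) lo' hi')
    (hr : 1 ≤ r) (h1 : r + ρ' / 8 ≤ ρ') (h2 : ρ' + ρ' / 8 ≤ R) {z : Site 2}
    (hz : z ∈ A.P'.support ∨ z ∈ A.V'.support) : z ∈ sqAnnulus r R := by
  have hx := A.hx
  have e0 : ((ρ' / 64 : ℕ) : ℤ) ≤ (ρ' / 8 : ℕ) := by exact_mod_cast Nat.div_le_div_left (by norm_num) (by norm_num)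
  have e3 : ρ' / 8 + ρ' / 8 ≤ ρ' := by omega
  have e3' : ((ρ' / 8 : ℕ) : ℤ) + (ρ' / 8 : ℕ) ≤ ρ' := by exact_mod_cast e3
  rcases hz with h | h
  · obtain ⟨h0, h1'⟩ := A.hP' z h
    have a0 := abs_le.1 (show |z 0 - A.x 0| ≤ (ρ' / 8 : ℕ) by omega)
    have a1 := abs_le.1 (show |z 1 - A.x 1| ≤ (ρ' / 8 : ℕ) by omega)
    exact mem_sqAnnulus_of_bounds hr (by omega) (by omega) (by omega) (by omega) (Or.inr (Or.inl (by omega)))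
  · obtain ⟨h0, h0', h1'⟩ := A.hV' z h
    have a1 := abs_le.1 h1'
    exact mem_sqAnnulus_of_bounds hr (by omega) (by omega) (by omega) (by omega) (Or.inr (Or.inl (by omega)))

/-- **Dual pieces attached to a fenced top dual arm are off the hole**: a face walk crossing
closed edges whose crossed edges have endpoints in the annulus `A_{n,N}` or among the fence sites
of a top dual arm of `A_{n,N}` (landing columns `[0, ·/64]`) has the dart property with respect to
`B(r-1)` once `r ≤ n - 1 - n/8`, `n ≤ N`. [folklore] -/
theorem ZdSepDualArmT.dartProp_of_fence {n N r : ℕ} {hi hi' : ℤ}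
    (D : ZdSepDualArmT ω n N 0 hi 0 hi') (hr : 1 ≤ r) (h1 : r + n / 8 + 1 ≤ n) (h2 : n ≤ N)
    {a b : Site 2} (Y : (zdGraph 2).Walk a b) (hYc : ∀ d ∈ Y.darts, sepEdge d.fst d.snd ∉ ω)
    (hYf : ∀ d ∈ Y.darts, ∀ v ∈ sepEdge d.fst d.snd, v ∈ sqAnnulus n N ∪ D.fenceSites) :
    ∀ d ∈ Y.darts, sepEdge d.fst d.snd ∉ ω ∧ ∀ v ∈ sepEdge d.fst d.snd, v ∉ box 2 (r - 1) := by
  intro d hd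
  refine ⟨hYc d hd, fun v hv => ?_⟩
  rcases hYf d hd v hv with h | h
  · exact notMem_box_of_mem_sqAnnulus (by omega) h
  · refine notMem_box_of_lt_apply 1 ?_
    rcases D.fenceSites_subset h with h | h
    · have := h.2.2.1; omega
    · have := h.2.2.1; omega

/-- Mirror image for a fenced bottom dual arm. [folklore] -/
theorem ZdSepDualArmB.dartProp_of_fence {n N r : ℕ} {hi hi' : ℤ}
    (D : ZdSepDualArmB ω n N 0 hi 0 hi') (hr : 1 ≤ r) (h1 : r + n / 8 + 1 ≤ n) (h2 : n ≤ N)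
    {a b : Site 2} (Y : (zdGraph 2).Walk a b) (hYc : ∀ d ∈ Y.darts, sepEdge d.fst d.snd ∉ ω)
    (hYf : ∀ d ∈ Y.darts, ∀ v ∈ sepEdge d.fst d.snd, v ∈ sqAnnulus n N ∪ D.fenceSites) :
    ∀ d ∈ Y.darts, sepEdge d.fst d.snd ∉ ω ∧ ∀ v ∈ sepEdge d.fst d.snd, v ∉ box 2 (r - 1) := by
  intro d hd
  refine ⟨hYc d hd, fun v hv => ?_⟩
  rcases hYf d hd v hv with h | h
  · exact notMem_box_of_mem_sqAnnulus (by omega) h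
  · refine notMem_box_of_apply_lt 1 ?_
    rcases D.fenceSites_subset h with h | h
    · have := h.2.2.2; omega
    · have := h.2.2.2; omega

/-- A face walk in the rows `≥ r` crossing closed edges has the dart property for `B(r-1)`.
[folklore] -/
theorem dartProp_of_rows_ge {r : ℕ} (hr : 1 ≤ r) {lo : ℤ} (hlo : (r : ℤ) ≤ lo) {a b : Site 2}
    (W : (zdGraph 2).Walk a b) (hWc : ∀ d ∈ W.darts, sepEdge d.fst d.snd ∉ ω)
    (hWs : ∀ z ∈ W.support, lo ≤ z 1) :
    ∀ d ∈ W.darts, sepEdge d.fst d.snd ∉ ω ∧ ∀ v ∈ sepEdge d.fst d.snd, v ∉ box 2 (r - 1) := by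
  intro d hd
  refine ⟨hWc d hd, fun v hv => notMem_box_of_lt_apply 1 ?_⟩
  have h1 := hWs _ (W.dart_fst_mem_support_of_mem_darts hd)
  have h2 := hWs _ (W.dart_snd_mem_support_of_mem_darts hd)
  have := (sepEdge_apply_le hv).2.1
  rcases le_total (d.fst 1) (d.snd 1) with h | h
  · rw [max_eq_right h] at this; omega
  · rw [max_eq_left h] at this; omega

/-- A face walk in the rows `≤ -r - 1` crossing closed edges has the dart property for `B(r-1)`.
[folklore] -/
theorem dartProp_of_rows_le {r : ℕ} (hr : 1 ≤ r) {hi : ℤ} (hhi : hi + 1 ≤ -(r : ℤ)) {a b : Site 2}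
    (W : (zdGraph 2).Walk a b) (hWc : ∀ d ∈ W.darts, sepEdge d.fst d.snd ∉ ω)
    (hWs : ∀ z ∈ W.support, z 1 ≤ hi) :
    ∀ d ∈ W.darts, sepEdge d.fst d.snd ∉ ω ∧ ∀ v ∈ sepEdge d.fst d.snd, v ∉ box 2 (r - 1) := by
  intro d hd
  refine ⟨hWc d hd, fun v hv => notMem_box_of_apply_lt 1 ?_⟩
  have h1 := hWs _ (W.dart_fst_mem_support_of_mem_darts hd)
  have h2 := hWs _ (W.dart_snd_mem_support_of_mem_darts hd)
  have := (sepEdge_apply_le hv).2.2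
  rcases le_total (d.fst 1) (d.snd 1) with h | h
  · rw [max_eq_right h] at this; omega
  · rw [max_eq_left h] at this; omega

/-- The body of a dual arm of `A_{m,N}` has the dart property for `B(r-1)`, `r ≤ m`. [folklore] -/
theorem dartProp_of_body {m N r : ℕ} (hrm : r ≤ m) (hr : 1 ≤ r) {a b : Site 2} (Q : (zdGraph 2).Walk a b)
    (hQc : ∀ d ∈ Q.darts, sepEdge d.fst d.snd ∉ ω)
    (hQa : ∀ d ∈ Q.darts, ∀ v ∈ sepEdge d.fst d.snd, v ∈ sqAnnulus m N) :
    ∀ d ∈ Q.darts, sepEdge d.fst d.snd ∉ ω ∧ ∀ v ∈ sepEdge d.fst d.snd, v ∉ box 2 (r - 1) :=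
  fun d hd => ⟨hQc d hd, fun v hv => notMem_box_of_mem_sqAnnulus (by omega) (hQa d hd v hv)⟩

/-- Darts of a reversed face walk cross closed edges if those of the walk do. [folklore] -/
theorem forall_darts_reverse_sepEdge_notMem {a b : Site 2} (X : (zdGraph 2).Walk a b)
    (hX : ∀ d ∈ X.darts, sepEdge d.fst d.snd ∉ ω) : ∀ d ∈ X.reverse.darts, sepEdge d.fst d.snd ∉ ω := by
  intro d hd
  rw [Walk.darts_reverse, List.mem_reverse, List.mem_map] at hd
  obtain ⟨d', hd', rfl⟩ := hd
  rw [sepEdge_dart_symm]; exact hX d' hd'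

end Locate

/-! ### The glued configuration has four arms -/

section Glue

variable {ω : BondConfig (Site 2)}

set_option maxHeartbeats 4000000 in
/-- **Deterministic gluing** (Kesten 1987, (2.43); Nolin 2008, proof of Prop. 12 (ii): extension of
well-separated arms through their free spaces, then junction in the middle annulus). Scales
`2 ≤ r`, `r + M₀ + 1 = n = r + K₀ + 2`, `ρ + M₁ + 2 = ρ' = ρ + K₁ + 4`, corridor heights
`h₀ ≤ min (r-1) (n/64)`, `h₁ ≤ min (r-2) (n/64)`, and room `r + n/8 + 1 ≤ n ≤ ρ`,
`ρ + ρ/8 + 1 ≤ ρ' - ρ'/8`, `ρ' + ρ'/8 ≤ R`, `8 ≤ n, ρ, ρ'`. On a lattice configuration carrying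
* fenced arms `A₁, B₁, D₁, E₁` (right, left, top, bottom) of the well-separated four-arm event of
  `A_{n,ρ}` and `A₂, B₂, D₂, E₂` of `A_{ρ',R}` (landing zones `[0, ·/64]`),
* open crossings of the corridors `[r, n-1] × [0, h₀]`, `[-(n-1), -r] × [0, h₀]`,
  `[ρ+1, ρ'-1] × [0, ρ/64]`, `[-(ρ'-1), -(ρ+1)] × [0, ρ/64]`,
* closed-dual crossings of the face corridors of columns `[0, h₁]` between the face rows `r - 1`
  and `n - 2`, resp. `-n + 1` and `-r`, and of columns `[0, ρ/64]` between the face rows `ρ + 1`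
  and `ρ' - 2`, resp. `-ρ' + 1` and `-ρ - 2`,
the four-arm event `fourArmTwoClusters r R` occurs, with inner witnesses on the east and west inner
sides and outer witnesses the outer endpoints of `A₂`, `B₂`. [cite: KestenScalingCMP1987, §2 Lemma 6 and (2.43)] [cite: Nolin2008, §4.3 Prop. 12 (ii), proof (arXiv 0711.4948: Prop. 11)] -/
theorem mem_fourArmTwoClusters_of_glue (hω : ω ⊆ (zdGraph 2).edgeSet)
    {r n ρ ρ' R M₀ K₀ M₁ K₁ h₀ h₁ : ℕ}
    (hr : 2 ≤ r) (hM₀ : r + M₀ + 1 = n) (hK₀ : r + K₀ + 2 = n) (hM₁ : ρ + M₁ + 2 = ρ') (hK₁ : ρ + K₁ + 4 = ρ')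
    (hh₀r : h₀ + 1 ≤ r) (hh₀n : h₀ ≤ n / 64) (hh₁r : h₁ + 2 ≤ r) (hh₁n : h₁ ≤ n / 64)
    (hn8 : 1 ≤ n / 8) (hrn : r + n / 8 + 1 ≤ n) (hnρ : n ≤ ρ) (hρ8 : 1 ≤ ρ / 8)
    (hρρ' : ρ + ρ / 8 + 1 ≤ ρ' - ρ' / 8) (hρ'8 : 1 ≤ ρ' / 8) (hρ'R : ρ' + ρ' / 8 ≤ R)
    (A₁ : ZdSepOpenArmR ω n ρ 0 (0 + (n / 64 : ℕ)) 0 (0 + (ρ / 64 : ℕ)))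
    (B₁ : ZdSepOpenArmL ω n ρ 0 (0 + (n / 64 : ℕ)) 0 (0 + (ρ / 64 : ℕ)))
    (D₁ : ZdSepDualArmT ω n ρ 0 (0 + (n / 64 : ℕ)) 0 (0 + (ρ / 64 : ℕ)))
    (E₁ : ZdSepDualArmB ω n ρ 0 (0 + (n / 64 : ℕ)) 0 (0 + (ρ / 64 : ℕ)))
    (A₂ : ZdSepOpenArmR ω ρ' R 0 (0 + (ρ' / 64 : ℕ)) 0 (0 + (R / 64 : ℕ)))
    (B₂ : ZdSepOpenArmL ω ρ' R 0 (0 + (ρ' / 64 : ℕ)) 0 (0 + (R / 64 : ℕ)))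
    (D₂ : ZdSepDualArmT ω ρ' R 0 (0 + (ρ' / 64 : ℕ)) 0 (0 + (R / 64 : ℕ)))
    (E₂ : ZdSepDualArmB ω ρ' R 0 (0 + (ρ' / 64 : ℕ)) 0 (0 + (R / 64 : ℕ)))
    (hT₀R : ω ∈ lrCrossingAt ![(r : ℤ), 0] M₀ h₀)
    (hT₀L : ω ∈ lrCrossingAt ![-((r : ℤ) + M₀), 0] M₀ h₀)
    (hT₁R : ω ∈ lrCrossingAt ![(ρ : ℤ) + 1, 0] M₁ (ρ / 64))
    (hT₁L : ω ∈ lrCrossingAt ![-((ρ : ℤ) + M₁ + 1), 0] M₁ (ρ / 64))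
    (hD₀T : ω ∈ dualTBCrossingAt ![0, (r : ℤ)] (h₁ + 1) K₀)
    (hD₀B : ω ∈ dualTBCrossingAt ![0, -((r : ℤ) + K₀)] (h₁ + 1) K₀)
    (hD₁T : ω ∈ dualTBCrossingAt ![0, (ρ : ℤ) + 2] (ρ / 64 + 1) K₁)
    (hD₁B : ω ∈ dualTBCrossingAt ![0, -((ρ : ℤ) + K₁ + 2)] (ρ / 64 + 1) K₁) :
    ω ∈ fourArmTwoClusters r R := by
  have hr1 : 1 ≤ r := by omega
  have hdiv₁ : ((ρ / 64 : ℕ) : ℤ) ≤ (ρ' / 64 : ℕ) := by exact_mod_cast Nat.div_le_div_right (by omega)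
  have hρR : ρ + ρ / 8 ≤ R := by omega
  have hrρ' : r + ρ' / 8 ≤ ρ' := by omega
  have hdivR : ((R / 64 : ℕ) : ℤ) ≤ R := by exact_mod_cast Nat.div_le_self R 64
  have hR1 : 1 ≤ R := by omega
  ------------------------------------------------------------------
  -- RIGHT open crossing
  ------------------------------------------------------------------
  obtain ⟨e, y₀, T₀, he0, hy₀, hT₀s, hT₀o⟩ := exists_walk_of_mem_lrCrossingAt hω hT₀R
  simp only [Matrix.cons_val_zero, Matrix.cons_val_one] at he0 hy₀ hT₀s
  obtain ⟨m₀, hm₀, U₀, hU₀s, hU₀o⟩ := A₁.exists_walk_of_innerCorridor hn8 T₀ (by omega) (by omega)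
    (fun z hz => ⟨by have := hT₀s z hz; omega, fun _ => by have := hT₀s z hz; omega⟩)
  obtain ⟨x₁, y₁, T₁, hx₁, hy₁, hT₁s, hT₁o⟩ := exists_walk_of_mem_lrCrossingAt hω hT₁R
  simp only [Matrix.cons_val_zero, Matrix.cons_val_one] at hx₁ hy₁ hT₁s
  obtain ⟨m₁, hm₁, U₁, hU₁s, hU₁o⟩ := A₁.exists_walk_of_outerCorridor hρ8 T₁ (by omega) (by omega)
    (fun z hz => ⟨by have := hT₁s z hz; omega, fun _ => by have := hT₁s z hz; omega⟩)
  obtain ⟨m₂, hm₂, U₂, hU₂s, hU₂o⟩ := A₂.exists_walk_of_innerCorridor_sharp hρ'8 T₁ (by omega) (by omega)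
    (fun z hz => ⟨by have := hT₁s z hz; omega, fun _ => by have := hT₁s z hz; omega⟩)
  obtain ⟨S₀, hS₀s, hS₀e⟩ := exists_walk_within_support T₀ T₀.start_mem_support hm₀
  obtain ⟨S₁, hS₁s, hS₁e⟩ := exists_walk_within_support T₁ hm₁ hm₂
  have okT₀ : ∀ z ∈ T₀.support, z ∈ sqAnnulus r R := fun z hz =>
    mem_sqAnnulus_of_corridorR hr1 (by omega) (by omega) (by omega) (hT₀s z hz)
  have okT₁ : ∀ z ∈ T₁.support, z ∈ sqAnnulus r R := fun z hz =>
    mem_sqAnnulus_of_corridorR hr1 (by omega) (by omega) (by omega) (hT₁s z hz)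
  have okA₁ := A₁.carrier_subset_sqAnnulus hr1 (by omega) hnρ hρR
  have hPR := openWalk_append S₀ (U₀.reverse.append (U₁.append (S₁.append (U₂.reverse.append A₂.W))))
    ⟨fun z hz => okT₀ z (hS₀s z hz), fun e he => hT₀o e (hS₀e e he)⟩
    (openWalk_append _ _ (openWalk_reverse U₀ ⟨fun z hz => okA₁ z (hU₀s z hz), hU₀o⟩)
      (openWalk_append _ _ ⟨fun z hz => okA₁ z (hU₁s z hz), hU₁o⟩
        (openWalk_append _ _ ⟨fun z hz => okT₁ z (hS₁s z hz), fun e he => hT₁o e (hS₁e e he)⟩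
          (openWalk_append _ _
            (openWalk_reverse U₂ ⟨fun z hz => A₂.inner_subset_sqAnnulus hr1 hrρ' hρ'R (hU₂s z hz), hU₂o⟩)
            ⟨fun z hz => sqAnnulus_mono (by omega) le_rfl (A₂.hW z hz), A₂.hWo⟩))))
  have connR : ω ∈ openConnIn (sqAnnulus r R) e A₂.z := mem_openConnIn_of_walk _ hPR.1 hPR.2
  ------------------------------------------------------------------
  -- LEFT open crossing
  ------------------------------------------------------------------
  obtain ⟨xL, w, T₀L, hxL, hw, hT₀Ls, hT₀Lo⟩ := exists_walk_of_mem_lrCrossingAt hω hT₀L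
  simp only [Matrix.cons_val_zero, Matrix.cons_val_one] at hxL hw hT₀Ls
  obtain ⟨m₀L, hm₀L, U₀L, hU₀Ls, hU₀Lo⟩ := B₁.exists_walk_of_innerCorridor hn8 T₀L.reverse (by omega) (by omega)
    (fun z hz => by
      rw [Walk.support_reverse, List.mem_reverse] at hz
      exact ⟨by have := hT₀Ls z hz; omega, fun _ => by have := hT₀Ls z hz; omega⟩)
  obtain ⟨x₁L, y₁L, T₁L, hx₁L, hy₁L, hT₁Ls, hT₁Lo⟩ := exists_walk_of_mem_lrCrossingAt hω hT₁L
  simp only [Matrix.cons_val_zero, Matrix.cons_val_one] at hx₁L hy₁L hT₁Ls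
  obtain ⟨m₁L, hm₁L, U₁L, hU₁Ls, hU₁Lo⟩ := B₁.exists_walk_of_outerCorridor hρ8 T₁L.reverse (by omega) (by omega)
    (fun z hz => by
      rw [Walk.support_reverse, List.mem_reverse] at hz
      exact ⟨by have := hT₁Ls z hz; omega, fun _ => by have := hT₁Ls z hz; omega⟩)
  obtain ⟨m₂L, hm₂L, U₂L, hU₂Ls, hU₂Lo⟩ := B₂.exists_walk_of_innerCorridor_sharp hρ'8 T₁L.reverse (by omega) (by omega)
    (fun z hz => by
      rw [Walk.support_reverse, List.mem_reverse] at hz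
      exact ⟨by have := hT₁Ls z hz; omega, fun _ => by have := hT₁Ls z hz; omega⟩)
  obtain ⟨S₀L, hS₀Ls, hS₀Le⟩ := exists_walk_within_support T₀L.reverse T₀L.reverse.start_mem_support hm₀L
  obtain ⟨S₁L, hS₁Ls, hS₁Le⟩ := exists_walk_within_support T₁L.reverse hm₁L hm₂L
  have okT₀L : ∀ z ∈ T₀L.reverse.support, z ∈ sqAnnulus r R := fun z hz => by
    rw [Walk.support_reverse, List.mem_reverse] at hz
    exact mem_sqAnnulus_of_corridorL hr1 (by omega) (by omega) (by omega) (hT₀Ls z hz)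
  have okT₀Le : ∀ e ∈ T₀L.reverse.edges, e ∈ ω := fun e he => by
    rw [Walk.edges_reverse, List.mem_reverse] at he; exact hT₀Lo e he
  have okT₁L : ∀ z ∈ T₁L.reverse.support, z ∈ sqAnnulus r R := fun z hz => by
    rw [Walk.support_reverse, List.mem_reverse] at hz
    exact mem_sqAnnulus_of_corridorL hr1 (by omega) (by omega) (by omega) (hT₁Ls z hz)
  have okT₁Le : ∀ e ∈ T₁L.reverse.edges, e ∈ ω := fun e he => by
    rw [Walk.edges_reverse, List.mem_reverse] at he; exact hT₁Lo e he
  have okB₁ := B₁.carrier_subset_sqAnnulus hr1 (by omega) hnρ hρR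
  have hPL := openWalk_append S₀L (U₀L.reverse.append (U₁L.append (S₁L.append (U₂L.reverse.append B₂.W))))
    ⟨fun z hz => okT₀L z (hS₀Ls z hz), fun e he => okT₀Le e (hS₀Le e he)⟩
    (openWalk_append _ _ (openWalk_reverse U₀L ⟨fun z hz => okB₁ z (hU₀Ls z hz), hU₀Lo⟩)
      (openWalk_append _ _ ⟨fun z hz => okB₁ z (hU₁Ls z hz), hU₁Lo⟩
        (openWalk_append _ _ ⟨fun z hz => okT₁L z (hS₁Ls z hz), fun e he => okT₁Le e (hS₁Le e he)⟩
          (openWalk_append _ _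
            (openWalk_reverse U₂L ⟨fun z hz => B₂.inner_subset_sqAnnulus hr1 hrρ' hρ'R (hU₂Ls z hz), hU₂Lo⟩)
            ⟨fun z hz => sqAnnulus_mono (by omega) le_rfl (B₂.hW z hz), B₂.hWo⟩))))
  have connL : ω ∈ openConnIn (sqAnnulus r R) w B₂.z := mem_openConnIn_of_walk _ hPL.1 hPL.2
  ------------------------------------------------------------------
  -- TOP dual arm from the face `(c₁ 0, r - 1)` to the level `R`
  ------------------------------------------------------------------
  obtain ⟨aT, bT, W₀, haT, hbT, hW₀s, hW₀c⟩ := exists_faceWalk_of_mem_dualTBCrossingAt hD₀T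
  simp only [Matrix.cons_val_zero, Matrix.cons_val_one] at haT hbT hW₀s
  obtain ⟨c₁, V₀, hc₁1, -, ⟨xT, hxT, hxT0, -⟩, hV₀s, hV₀c, hV₀off⟩ :=
    exists_faceWalk_exit_row_lt W₀ hW₀c r (by omega) (by omega)
  have hc₁0 : 0 ≤ c₁ 0 ∧ c₁ 0 ≤ h₁ := by have := hW₀s xT hxT; omega
  obtain ⟨mT₀, hmT₀, Y₀, -, hY₀c, hY₀f⟩ := D₁.exists_faceWalk_of_innerCorridor hn8 V₀.reverse (by omega) (by omega)
    (fun z hz => by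
      rw [Walk.support_reverse, List.mem_reverse] at hz
      have := hW₀s z (hV₀s z hz)
      exact ⟨by omega, fun _ => by omega⟩)
  obtain ⟨aM, bM, W₁, haM, hbM, hW₁s, hW₁c⟩ := exists_faceWalk_of_mem_dualTBCrossingAt hD₁T
  simp only [Matrix.cons_val_zero, Matrix.cons_val_one] at haM hbM hW₁s
  obtain ⟨mT₁, hmT₁, Y₁, -, hY₁c, hY₁f⟩ := D₁.exists_faceWalk_of_outerCorridor hρ8 W₁.reverse (by omega) (by omega)
    (fun z hz => by
      rw [Walk.support_reverse, List.mem_reverse] at hz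
      have := hW₁s z hz
      exact ⟨by omega, fun _ => by omega⟩)
  obtain ⟨mT₂, hmT₂, Y₂, -, hY₂c, hY₂f⟩ := D₂.exists_faceWalk_of_innerCorridor hρ'8 W₁.reverse (by omega) (by omega)
    (fun z hz => by
      rw [Walk.support_reverse, List.mem_reverse] at hz
      have := hW₁s z hz
      exact ⟨by omega, fun _ => by omega⟩)
  obtain ⟨Z₀, -, hZ₀d⟩ := exists_faceWalk_within_support V₀.reverse V₀.reverse.start_mem_support hmT₀
  obtain ⟨Z₁, -, hZ₁d⟩ := exists_faceWalk_within_support W₁.reverse hmT₁ hmT₂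
  have okV₀ : ∀ d ∈ V₀.reverse.darts, sepEdge d.fst d.snd ∉ ω ∧ ∀ v ∈ sepEdge d.fst d.snd, v ∉ box 2 (r - 1) :=
    faceWalk_reverse V₀ fun d hd => ⟨hV₀c d hd, fun v hv => notMem_box_of_lt_apply 1 (by have := hV₀off d hd v hv; omega)⟩
  have okY₀ := D₁.dartProp_of_fence hr1 hrn hnρ Y₀ hY₀c (fun d hd v hv => Or.inr (hY₀f d hd v hv))
  have okY₁ := D₁.dartProp_of_fence hr1 hrn hnρ Y₁ hY₁c hY₁f
  have okW₁ := faceWalk_reverse W₁ (dartProp_of_rows_ge hr1 (lo := (ρ : ℤ) + 2 - 1) (by omega) W₁ hW₁c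
    (fun z hz => (hW₁s z hz).2.2.1))
  have okY₂ := D₂.dartProp_of_fence hr1 (by omega) (by omega) Y₂ hY₂c (fun d hd v hv => Or.inr (hY₂f d hd v hv))
  have okQ₂ := dartProp_of_body (by omega : r ≤ ρ') hr1 D₂.Q D₂.hQc D₂.hQa
  have hδ₁ := faceWalk_append Z₀ (Y₀.reverse.append (Y₁.append (Z₁.append (Y₂.reverse.append D₂.Q))))
    (faceWalk_of_within _ okV₀ Z₀ hZ₀d)
    (faceWalk_append _ _ (faceWalk_reverse Y₀ okY₀)
      (faceWalk_append _ _ okY₁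
        (faceWalk_append _ _ (faceWalk_of_within _ okW₁ Z₁ hZ₁d)
          (faceWalk_append _ _ (faceWalk_reverse Y₂ okY₂) okQ₂))))
  have hgD₂ := D₂.hg
  ------------------------------------------------------------------
  -- BOTTOM dual arm from the face `(c₂ 0, -r)` to the level `-R-1`
  ------------------------------------------------------------------
  obtain ⟨aB, bB, X₀, haB, hbB, hX₀s, hX₀c⟩ := exists_faceWalk_of_mem_dualTBCrossingAt hD₀B
  simp only [Matrix.cons_val_zero, Matrix.cons_val_one] at haB hbB hX₀s
  obtain ⟨c₂, V₀', hc₂1, -, ⟨xB, hxB, hxB0, -⟩, hV₀'s, hV₀'c, hV₀'off⟩ :=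
    exists_faceWalk_exit_row_ge X₀.reverse (forall_darts_reverse_sepEdge_notMem X₀ hX₀c) r (by omega) (by omega)
  have hc₂0 : 0 ≤ c₂ 0 ∧ c₂ 0 ≤ h₁ := by
    rw [Walk.support_reverse, List.mem_reverse] at hxB
    have := hX₀s xB hxB; omega
  obtain ⟨mB₀, hmB₀, Y₀', -, hY₀'c, hY₀'f⟩ := E₁.exists_faceWalk_of_innerCorridor hn8 V₀'.reverse (by omega) (by omega)
    (fun z hz => by
      rw [Walk.support_reverse, List.mem_reverse] at hz
      have hz' := hV₀'s z hz
      rw [Walk.support_reverse, List.mem_reverse] at hz'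
      have := hX₀s z hz'
      exact ⟨by omega, fun _ => by omega⟩)
  obtain ⟨aN, bN, X₁, haN, hbN, hX₁s, hX₁c⟩ := exists_faceWalk_of_mem_dualTBCrossingAt hD₁B
  simp only [Matrix.cons_val_zero, Matrix.cons_val_one] at haN hbN hX₁s
  obtain ⟨mB₁, hmB₁, Y₁', -, hY₁'c, hY₁'f⟩ := E₁.exists_faceWalk_of_outerCorridor hρ8 X₁ (by omega) (by omega)
    (fun z hz => by have := hX₁s z hz; exact ⟨by omega, fun _ => by omega⟩)
  obtain ⟨mB₂, hmB₂, Y₂', -, hY₂'c, hY₂'f⟩ := E₂.exists_faceWalk_of_innerCorridor hρ'8 X₁ (by omega) (by omega)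
    (fun z hz => by have := hX₁s z hz; exact ⟨by omega, fun _ => by omega⟩)
  obtain ⟨Z₀', -, hZ₀'d⟩ := exists_faceWalk_within_support V₀'.reverse V₀'.reverse.start_mem_support hmB₀
  obtain ⟨Z₁', -, hZ₁'d⟩ := exists_faceWalk_within_support X₁ hmB₁ hmB₂
  have okV₀' : ∀ d ∈ V₀'.reverse.darts, sepEdge d.fst d.snd ∉ ω ∧ ∀ v ∈ sepEdge d.fst d.snd, v ∉ box 2 (r - 1) :=
    faceWalk_reverse V₀' fun d hd =>
      ⟨hV₀'c d hd, fun v hv => notMem_box_of_apply_lt 1 (by have := hV₀'off d hd v hv; omega)⟩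
  have okY₀' := E₁.dartProp_of_fence hr1 hrn hnρ Y₀' hY₀'c (fun d hd v hv => Or.inr (hY₀'f d hd v hv))
  have okY₁' := E₁.dartProp_of_fence hr1 hrn hnρ Y₁' hY₁'c hY₁'f
  have okX₁ := dartProp_of_rows_le hr1 (hi := -((ρ : ℤ) + K₁ + 2) + K₁) (by omega) X₁ hX₁c
    (fun z hz => (hX₁s z hz).2.2.2)
  have okY₂' := E₂.dartProp_of_fence hr1 (by omega) (by omega) Y₂' hY₂'c (fun d hd v hv => Or.inr (hY₂'f d hd v hv))
  have okQ₂' := dartProp_of_body (by omega : r ≤ ρ') hr1 E₂.Q E₂.hQc E₂.hQa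
  have hδ₂ := faceWalk_append Z₀' (Y₀'.reverse.append (Y₁'.append (Z₁'.append (Y₂'.reverse.append E₂.Q))))
    (faceWalk_of_within _ okV₀' Z₀' hZ₀'d)
    (faceWalk_append _ _ (faceWalk_reverse Y₀' okY₀')
      (faceWalk_append _ _ okY₁'
        (faceWalk_append _ _ (faceWalk_of_within _ okX₁ Z₁' hZ₁'d)
          (faceWalk_append _ _ (faceWalk_reverse Y₂' okY₂') okQ₂'))))
  have hgE₂ := E₂.hg
  ------------------------------------------------------------------
  -- assembly
  ------------------------------------------------------------------
  have he1 : 0 ≤ e 1 ∧ e 1 ≤ h₀ := by have := hT₀s e T₀.start_mem_support; omega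
  have hw1 : 0 ≤ w 1 ∧ w 1 ≤ h₀ := by have := hT₀Ls w T₀L.end_mem_support; omega
  have hw' : w 0 = -(r : ℤ) := by omega
  have hzA₂ := A₂.hz
  have hzB₂ := B₂.hz
  have hsep : ω ∉ openConnIn (sqAnnulus r R) e w :=
    not_openConnIn_sqAnnulus_of_dualArmsTB hr (by omega) hω he0 (abs_le.2 ⟨by omega, by omega⟩)
      hw' (abs_le.2 ⟨by omega, by omega⟩)
      _ ⟨by omega, by omega, by omega⟩ (by omega) hδ₁ _ ⟨by omega, by omega, by omega⟩ (by omega) hδ₂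
  exact ⟨e, mem_siteSphere_of_apply_zero hr1 (Or.inl he0) (abs_le.2 ⟨by omega, by omega⟩),
    w, mem_siteSphere_of_apply_zero hr1 (Or.inr hw') (abs_le.2 ⟨by omega, by omega⟩),
    A₂.z, mem_siteSphere_of_apply_zero hR1 (Or.inl hzA₂.1) (abs_le.2 ⟨by omega, by omega⟩),
    B₂.z, mem_siteSphere_of_apply_zero hR1 (Or.inr hzB₂.1) (abs_le.2 ⟨by omega, by omega⟩),
    connR, connL, hsep⟩

end Glue


end Literature.Probability.Percolation

end
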